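import Literature.NumberTheory.EllipticCurves.FineSelmerFixedFieldMuRoad
import HarnessLib

/-!
# Coates–Sujatha's Conjecture A from the classical `μ`-invariant of the point–line field `K(P, ⟨Q⟩)`:
# an image-free `μ`-road (`p` odd, `E[p]` irreducible; proved)

`Proofs`-style file (theorems only: no definition, no named fact, no `sorry`) in topic
`NumberTheory/EllipticCurves`, written by the literature seat `bsd-potss-conjA-anchor` g20 (cell `bsd-potss`;
serves the asides stmt-BirchSwinnertonDyer-19386 / 19413; closes nothing; (A) / BSD is proved for no
particular curve here).  Namespaces `Literature.NumberTheory.EllipticCurves.FineSelmerStabilizerDescent` (§1)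
and `…EllipticCurves.CoatesSujatha2005` (§2–§3).

THE THEOREM (`CoatesSujatha2005.conjA_of_classicalMuVanishes_pointLineField`).  `K` a number field,
`E = W/K` elliptic, `p` an ODD prime with `E[p]` IRREDUCIBLE, `P, Q ∈ E[p]` with `P ≠ 0` and `Q ∉ ⟨P⟩`.  Let
`Θ = Stab(P) ∩ Stab(⟨Q⟩) ≤ Γ_K` (the elements fixing the point `P` and the LINE `⟨Q⟩ = ℤQ`; `Stab(⟨Q⟩)` is the
stabiliser for the pointwise action of `Γ_K` on subgroups of `E[p]`, `open scoped Pointwise`) and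
`K(P,⟨Q⟩) = K̄^Θ`.  IF every (equivalently one) cyclotomic `ℤ_p`-extension of `K(P,⟨Q⟩)` has vanishing classical
`μ`-invariant, THEN statement (A) of Coates–Sujatha holds for `E` at `p` (`∃ γ D, Module.Finite ℤ_[p] D.X`).
NO hypothesis on the image of `ρ̄_{E,p}` (no tameness, no surjectivity, nothing at `p` or at the bad primes):
in the basis `(P, Q)` the image of `Θ` in `Gal(K(E[p])/K) ≤ GL₂(𝔽_p)` lies in `{diag(1, d)}`, of order
`≤ p - 1`, so the sibling's tame-free road (`conjA_of_classicalMuVanishes_fixedField`, file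
`FineSelmerFixedFieldMuRoad`) applies (§1: `#res_{K(E[p])}(Θ) ≤ p - 1`, via `h ↦ h̃ • Q ∈ ⟨Q⟩ ∖ 0`, injective
because an automorphism fixing `P` and `Q` fixes `E[p] = ⟨P⟩ ⊕ ⟨Q⟩`).  Degrees: `[K(P,⟨Q⟩) : K] ≤ (p² - 1)p`;
for a `GL₂(𝔽₃)`-image curve over `ℚ` (the surjective-mod-`3` rows of the cell's item 19386, where every door
needing `3 ∤ #Gal(ℚ(E[3])/ℚ)` is void) `K(P,⟨Q⟩) = ℚ(x_P, y_P, x_Q)` has degree `24` (vs `48` for `ℚ(E[3])` in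
Coates–Sujatha's Thm. 3.4), its first cyclotomic layer degree `72`.  Numeric doors (§3): Iwasawa 1956 and Fukuda
1994 Thm. 1 (1)/(2) from any layer `n₀` of total ramification, at `K(P,⟨Q⟩)`.

References: [CoatesSujatha2005] J. Coates, R. Sujatha, *Fine Selmer groups of elliptic curves over `p`-adic Lie
extensions*, Math. Ann. 331 (2005), §3 Thm. 3.4, Lemma 3.8; [DeoRaySujatha2023] S. V. Deo, A. Ray, R. Sujatha, *On the
μ equals zero conjecture for fine Selmer groups in Iwasawa theory*, PAMQ 19 (2023), §3 Thm. 3.9, §5 Lemma 5.1;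
[Serre1972] J.-P. Serre, Invent. Math. 15 (1972), §2; [SilvermanAEC2009] VIII §1; [Washington1997] §13.1, §13.3;
[Fukuda1994] Thm. 1; [Greenberg2001IwasawaPastPresent] Prop. 2.1.
-/

set_option autoImplicit false

noncomputable section

open scoped Classical Pointwise NumberField
open NumberField IsDedekindDomain Field IntermediateField

namespace Literature.NumberTheory.EllipticCurves.FineSelmerStabilizerDescent

open Literature.NumberTheory.GaloisRepresentations Literature.NumberTheory.NumberFields
  Literature.NumberTheory.EllipticCurves

/-! ## §1 The point–line stabiliser `Stab(P) ∩ Stab(⟨Q⟩)`: contains `Gal(K̄/K(E[p]))`, image of order `≤ p - 1` -/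

variable {K : Type} [Field K] [NumberField K] {p : ℕ} [Fact p.Prime] (W : WeierstrassCurve K) [W.IsElliptic]

/-- In a `p`-torsion abelian group a non-zero element generates a subgroup of order `p`. [folklore] -/
private theorem natCard_zmultiples_eq' {V : Type*} [AddCommGroup V] (hpV : ∀ v : V, p • v = 0) {w : V}
    (hw : w ≠ 0) : Nat.card (AddSubgroup.zmultiples w) = p := by
  rw [Nat.card_zmultiples]
  exact addOrderOf_eq_prime (hpV w) hw

/-- `P ≠ 0` and `Q ∉ ⟨P⟩` in an abelian group of order `p²` killed by `p`: every element is `a • P + b • Q`. [folklore] -/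
private theorem exists_eq_zsmul_add_zsmul' {V : Type*} [AddCommGroup V] [Finite V] (hpV : ∀ v : V, p • v = 0)
    (hcard : Nat.card V = p ^ 2) {P Q : V} (hP0 : P ≠ 0) (hQ : Q ∉ AddSubgroup.zmultiples P) (v : V) :
    ∃ a b : ℤ, v = a • P + b • Q := by
  have hp : p.Prime := Fact.out
  set S := AddSubgroup.zmultiples P ⊔ AddSubgroup.zmultiples Q with hS
  have hcard₀ : Nat.card (AddSubgroup.zmultiples P) = p := natCard_zmultiples_eq' hpV hP0
  have hdvdS : Nat.card S ∣ p ^ 2 := hcard ▸ AddSubgroup.card_addSubgroup_dvd_card S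
  have hpS : p ∣ Nat.card S := hcard₀ ▸ AddSubgroup.card_dvd_of_le (le_sup_left : _ ≤ S)
  obtain ⟨k, hk2, hk⟩ := (Nat.dvd_prime_pow hp).mp hdvdS
  have hk0 : k ≠ 0 := by
    rintro rfl
    rw [hk, pow_zero, Nat.dvd_one] at hpS
    exact hp.one_lt.ne' hpS
  have hk1 : k ≠ 1 := by
    rintro rfl
    rw [pow_one] at hk
    have hSeq : AddSubgroup.zmultiples P = S :=
      AddSubgroup.eq_of_le_of_card_ge (le_sup_left : _ ≤ S) (by rw [hk, hcard₀])
    exact hQ (hSeq ▸ (le_sup_right : AddSubgroup.zmultiples Q ≤ S) (AddSubgroup.mem_zmultiples Q))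
  have hk' : k = 2 := by omega
  have hStop : S = ⊤ := AddSubgroup.eq_top_of_card_eq S (by rw [hk, hk', hcard])
  have hv : v ∈ S := hStop ▸ AddSubgroup.mem_top v
  obtain ⟨y, hy, z, hz, hyz⟩ := AddSubgroup.mem_sup.mp hv
  obtain ⟨a, rfl⟩ := AddSubgroup.mem_zmultiples_iff.mp hy
  obtain ⟨b, rfl⟩ := AddSubgroup.mem_zmultiples_iff.mp hz
  exact ⟨a, b, hyz.symm⟩

omit [NumberField K] [Fact p.Prime] [W.IsElliptic] in
/-- `g • (k • w) = k • (g • w)` for the Galois action and an integer `k`. [folklore] -/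
private theorem smul_zsmul_comm' (g : absoluteGaloisGroup K) (k : ℤ) (w : ↥(W.geomTorsion (p : ℤ))) :
    g • (k • w) = k • (g • w) :=
  map_zsmul (DistribSMul.toAddMonoidHom ↥(W.geomTorsion (p : ℤ)) g) k w

omit [NumberField K] [Fact p.Prime] [W.IsElliptic] in
/-- **`Gal(K̄/K(E[p])) ≤ Stab(P) ∩ Stab(⟨Q⟩)`**: an element acting trivially on `E[p]` fixes every point and every
subgroup of `E[p]`. [cite: SilvermanAEC2009, VIII.§1 (K(E[m]) is the fixed field of the kernel of ρ̄)] -/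
theorem fixingSubgroupOfModule_le_stabilizer_inf_stabilizer_zmultiples (P Q : ↥(W.geomTorsion (p : ℤ))) :
    fixingSubgroupOfModule K ↥(W.geomTorsion (p : ℤ)) ≤
      MulAction.stabilizer (absoluteGaloisGroup K) P ⊓
        MulAction.stabilizer (absoluteGaloisGroup K) (AddSubgroup.zmultiples Q) := by
  intro σ hσ
  refine Subgroup.mem_inf.mpr ⟨MulAction.mem_stabilizer_iff.mpr (smul_eq_of_mem_fixingSubgroupOfModule hσ P),
    MulAction.mem_stabilizer_iff.mpr ?_⟩
  ext x
  rw [AddSubgroup.mem_smul_pointwise_iff_exists]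
  constructor
  · rintro ⟨s, hs, rfl⟩
    rwa [smul_eq_of_mem_fixingSubgroupOfModule hσ s]
  · intro hx
    exact ⟨x, hx, smul_eq_of_mem_fixingSubgroupOfModule hσ x⟩

/-- **The image of `Stab(P) ∩ Stab(⟨Q⟩)` in `Gal(K(E[p])/K)` has at most `p - 1` elements** (`P ≠ 0`, `Q ∉ ⟨P⟩`):
`h ↦ h̃ • Q` (any lift `h̃ ∈ Stab(P) ∩ Stab(⟨Q⟩)`) maps it injectively into `⟨Q⟩ ∖ {0}` — two lifts with the same
value differ by an element fixing `P` and `Q`, hence all of `E[p] = ⟨P⟩ + ⟨Q⟩`, hence restricting trivially to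
`K(E[p])`.  (In a basis `(P, Q)` of `E[p]` the image is contained in `{diag(1, d) : d ∈ 𝔽_pˣ}`.)
[cite: Serre1972, §2.1–§2.2 (subgroups of GL₂(𝔽_p): the split Cartan subgroup and its stabilisers)]
[cite: SilvermanAEC2009, Cor. III.6.4(b) and VIII.§1] -/
theorem natCard_map_stabilizer_inf_stabilizer_zmultiples_le [NeZero p] (P Q : ↥(W.geomTorsion (p : ℤ)))
    (hP0 : P ≠ 0) (hQ : Q ∉ AddSubgroup.zmultiples P) :
    Nat.card ↥((MulAction.stabilizer (absoluteGaloisGroup K) P ⊓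
        MulAction.stabilizer (absoluteGaloisGroup K) (AddSubgroup.zmultiples Q)).map
          (absRestrictNormalHom (W.divisionField p))) ≤ p - 1 := by
  have hp : p.Prime := Fact.out
  have hcardV : Nat.card ↥(W.geomTorsion (p : ℤ)) = p ^ 2 := ModPIrreducibleLayer.natCard_geomTorsion_eq_sq W
  haveI : Finite ↥(W.geomTorsion (p : ℤ)) :=
    Nat.finite_of_card_ne_zero (by rw [hcardV]; exact pow_ne_zero 2 hp.ne_zero)
  have hpV : ∀ v : ↥(W.geomTorsion (p : ℤ)), p • v = 0 := fun v =>
    Subtype.ext (by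
      rw [AddSubmonoidClass.coe_nsmul, ZeroMemClass.coe_zero]
      exact AddSubgroup.torsionBy.nsmul_iff.mp v.2)
  have hQ0 : Q ≠ 0 := by
    rintro rfl
    exact hQ (zero_mem _)
  set Θ : Subgroup (absoluteGaloisGroup K) := MulAction.stabilizer (absoluteGaloisGroup K) P ⊓
    MulAction.stabilizer (absoluteGaloisGroup K) (AddSubgroup.zmultiples Q) with hΘ
  set H : Subgroup ((W.divisionField p) ≃ₐ[K] (W.divisionField p)) :=
    Θ.map (absRestrictNormalHom (W.divisionField p)) with hHdef
  have hlift : ∀ h : H, ∃ g : absoluteGaloisGroup K, g ∈ Θ ∧ absRestrictNormalHom (W.divisionField p) g = h :=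
    fun h => Subgroup.mem_map.mp h.2
  choose lift hlift_mem hlift_res using hlift
  have hliftP : ∀ h : H, lift h • P = P := fun h =>
    MulAction.mem_stabilizer_iff.mp (Subgroup.mem_inf.mp (hlift_mem h)).1
  have hliftQ : ∀ h : H, lift h • Q ∈ AddSubgroup.zmultiples Q := by
    intro h
    have hst : lift h • AddSubgroup.zmultiples Q = AddSubgroup.zmultiples Q :=
      MulAction.mem_stabilizer_iff.mp (Subgroup.mem_inf.mp (hlift_mem h)).2
    have := AddSubgroup.smul_mem_pointwise_smul Q (lift h) (AddSubgroup.zmultiples Q) (AddSubgroup.mem_zmultiples Q)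
    rwa [hst] at this
  -- `φ h = h̃ • Q`
  let φ : H → ↥(W.geomTorsion (p : ℤ)) := fun h => lift h • Q
  have hφinj : Function.Injective φ := by
    intro h h' hhh
    have hQ' : ((lift h)⁻¹ * lift h') • Q = Q := by
      rw [mul_smul, show lift h' • Q = lift h • Q from hhh.symm, inv_smul_smul]
    have hP' : ((lift h)⁻¹ * lift h') • P = P := by
      rw [mul_smul, hliftP h', ← hliftP h, inv_smul_smul, hliftP h]
    -- `σ = h̃⁻¹ h̃'` fixes `E[p] = ⟨P⟩ + ⟨Q⟩`
    have hfix : ∀ v : ↥(W.geomTorsion (p : ℤ)), ((lift h)⁻¹ * lift h') • v = v := by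
      intro v
      obtain ⟨a, b, rfl⟩ := exists_eq_zsmul_add_zsmul' hpV hcardV hP0 hQ v
      rw [smul_add, smul_zsmul_comm', smul_zsmul_comm', hP', hQ']
    have hres : absRestrictNormalHom (W.divisionField p) ((lift h)⁻¹ * lift h') = 1 :=
      (W.absRestrictNormalHom_divisionField_eq_one_iff p _).mpr hfix
    rw [map_mul, map_inv, hlift_res, hlift_res, inv_mul_eq_one] at hres
    exact Subtype.ext hres
  have hrange : Set.range φ ⊆ (AddSubgroup.zmultiples Q : Set ↥(W.geomTorsion (p : ℤ))) \ {0} := by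
    rintro _ ⟨h, rfl⟩
    refine ⟨hliftQ h, ?_⟩
    rw [Set.mem_singleton_iff]
    exact fun h0 => hQ0 ((smul_eq_zero_iff_eq (lift h)).mp h0)
  have hfin : ((AddSubgroup.zmultiples Q : Set ↥(W.geomTorsion (p : ℤ))) \ {0}).Finite := Set.toFinite _
  calc Nat.card H = (Set.range φ).ncard := (Set.ncard_range_of_injective hφinj).symm
    _ ≤ ((AddSubgroup.zmultiples Q : Set ↥(W.geomTorsion (p : ℤ))) \ {0}).ncard := Set.ncard_le_ncard hrange hfin
    _ = (AddSubgroup.zmultiples Q : Set ↥(W.geomTorsion (p : ℤ))).ncard - 1 :=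
        Set.ncard_sdiff_singleton_of_mem (AddSubgroup.zero_mem _)
    _ = p - 1 := by
        rw [← Nat.card_coe_set_eq]
        change Nat.card ↥(AddSubgroup.zmultiples Q) - 1 = p - 1
        rw [natCard_zmultiples_eq' hpV hQ0]

/-- **`p ∤ #res_{K(E[p])}(Stab(P) ∩ Stab(⟨Q⟩))`** for `P ≠ 0`, `Q ∉ ⟨P⟩`: the image has between `1` and `p - 1`
elements. [cite: Serre1972, §2.1–§2.2] [cite: SilvermanAEC2009, Cor. III.6.4(b) and VIII.§1] -/
theorem not_dvd_natCard_map_stabilizer_inf_stabilizer_zmultiples [NeZero p] (P Q : ↥(W.geomTorsion (p : ℤ)))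
    (hP0 : P ≠ 0) (hQ : Q ∉ AddSubgroup.zmultiples P) :
    ¬ p ∣ Nat.card ↥((MulAction.stabilizer (absoluteGaloisGroup K) P ⊓
        MulAction.stabilizer (absoluteGaloisGroup K) (AddSubgroup.zmultiples Q)).map
          (absRestrictNormalHom (W.divisionField p))) := by
  have hp : p.Prime := Fact.out
  intro hdvd
  have hle := natCard_map_stabilizer_inf_stabilizer_zmultiples_le W P Q hP0 hQ
  have hpos : 0 < Nat.card ↥((MulAction.stabilizer (absoluteGaloisGroup K) P ⊓
      MulAction.stabilizer (absoluteGaloisGroup K) (AddSubgroup.zmultiples Q)).map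
        (absRestrictNormalHom (W.divisionField p))) := Nat.card_pos
  have := Nat.le_of_dvd hpos hdvd
  have h1 := hp.one_lt
  omega

/-- **A point–line pair exists**: `E[p]` (order `p²`) contains `P ≠ 0` and `Q ∉ ⟨P⟩` (`#⟨P⟩ = p < p²`).
[cite: SilvermanAEC2009, Cor. III.6.4(b) (E[p] ≅ (ℤ/p)²)] -/
theorem exists_ne_zero_and_not_mem_zmultiples [NeZero p] :
    ∃ P Q : ↥(W.geomTorsion (p : ℤ)), P ≠ 0 ∧ Q ∉ AddSubgroup.zmultiples P := by
  have hp : p.Prime := Fact.out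
  have hcardV : Nat.card ↥(W.geomTorsion (p : ℤ)) = p ^ 2 := ModPIrreducibleLayer.natCard_geomTorsion_eq_sq W
  haveI : Finite ↥(W.geomTorsion (p : ℤ)) :=
    Nat.finite_of_card_ne_zero (by rw [hcardV]; exact pow_ne_zero 2 hp.ne_zero)
  have hpV : ∀ v : ↥(W.geomTorsion (p : ℤ)), p • v = 0 := fun v =>
    Subtype.ext (by
      rw [AddSubmonoidClass.coe_nsmul, ZeroMemClass.coe_zero]
      exact AddSubgroup.torsionBy.nsmul_iff.mp v.2)
  have hlt : p < p ^ 2 := by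
    calc p = p ^ 1 := (pow_one p).symm
      _ < p ^ 2 := Nat.pow_lt_pow_right hp.one_lt (by norm_num)
  haveI : Nontrivial ↥(W.geomTorsion (p : ℤ)) :=
    Finite.one_lt_card_iff_nontrivial.mp (by rw [hcardV]; exact lt_trans hp.one_lt hlt)
  obtain ⟨P, hP0⟩ := exists_ne (0 : ↥(W.geomTorsion (p : ℤ)))
  have hne : AddSubgroup.zmultiples P ≠ ⊤ := by
    intro htop
    have h1 : Nat.card (AddSubgroup.zmultiples P) = p := natCard_zmultiples_eq' hpV hP0
    rw [htop, AddSubgroup.card_top, hcardV] at h1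
    exact hlt.ne' h1
  obtain ⟨Q, -, hQ⟩ := SetLike.exists_of_lt (lt_top_iff_ne_top.mpr hne)
  exact ⟨P, Q, hP0, hQ⟩

end Literature.NumberTheory.EllipticCurves.FineSelmerStabilizerDescent

/-! ## §2 Statement (A) from `μ_p(K(P,⟨Q⟩)_cyc) = 0` — no image hypothesis -/

namespace Literature.NumberTheory.EllipticCurves.CoatesSujatha2005

open WeierstrassCurve Literature.NumberTheory.IwasawaTheory Literature.NumberTheory.GaloisRepresentations
  Literature.NumberTheory.NumberFields Literature.NumberTheory.EllipticCurves
  Literature.NumberTheory.EllipticCurves.ZpExtension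
  Literature.NumberTheory.EllipticCurves.FineSelmerStabilizerDescent

variable {K : Type} [Field K] [NumberField K] (W : WeierstrassCurve K) [W.IsElliptic] {p : ℕ} [Fact p.Prime]

/-- **Coates–Sujatha's statement (A) from BOUNDED `p`-RANKS along the cyclotomic tower of the point–line field
`K(P,⟨Q⟩) = K̄^{Stab(P) ∩ Stab(⟨Q⟩)}`** (proved; `p` odd, `E[p]` irreducible, `P ≠ 0`, `Q ∉ ⟨P⟩`; NO image
hypothesis).  If some cyclotomic `ℤ_p`-extension `κ'` of `K(P,⟨Q⟩)` has `rank_p Cl(K(P,⟨Q⟩)_m) ≤ B` for every layer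
`m`, then for the cyclotomic `ℤ_p`-extension `κ` of `K` the dual fine Selmer group of `E` over `K_∞` is finitely
generated over `ℤ_p`. [cite: CoatesSujatha2005, §3 Lemma 3.8 and Thm. 3.4] [cite: DeoRaySujatha2023, §5 Lemma 5.1]
[cite: Washington1997, §13.1] -/
theorem fineSelmerDual_moduleFinite_of_classGroupPRank_pointLineField_le (hp : p ≠ 2)
    (hirr : W.HasIrreducibleModPGaloisRep p) (P Q : ↥(W.geomTorsion (p : ℤ))) (hP0 : P ≠ 0)
    (hQ : Q ∉ AddSubgroup.zmultiples P) (κ : ZpExtension K p) (hκ : κ.IsCyclotomic) (B : ℕ)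
    (hB : ∃ κ' : ZpExtension ↥(fixedField (MulAction.stabilizer (absoluteGaloisGroup K) P ⊓
        MulAction.stabilizer (absoluteGaloisGroup K) (AddSubgroup.zmultiples Q)) :
          IntermediateField K (AlgebraicClosure K)) p,
      κ'.IsCyclotomic ∧ ∀ m, classGroupPRank κ' m ≤ B) :
    ∃ (γ : absoluteGaloisGroup K) (D : W.FineSelmerDualData κ γ),
      Module.Finite ℤ_[p] (RestrictScalars ℤ_[p] (IwasawaAlgebra p) D.X) := by
  haveI : NeZero p := ⟨(Fact.out : p.Prime).ne_zero⟩
  exact fineSelmerDual_moduleFinite_of_classGroupPRank_fixedField_le W hp hirr _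
    (fixingSubgroupOfModule_le_stabilizer_inf_stabilizer_zmultiples W P Q) P hP0 inf_le_left
    (not_dvd_natCard_map_stabilizer_inf_stabilizer_zmultiples W P Q hP0 hQ) κ hκ B hB

/-- **THE POINT–LINE-FIELD `μ`-ROAD (PROVED, IMAGE-FREE): `E[p]` irreducible (`p` odd) and
`μ_p(K(P,⟨Q⟩)_cyc) = 0` ⟹ statement (A) for `E` at `p`.**  `E = W` elliptic over a number field `K`, `p` an odd
prime, `E[p]` an irreducible `Γ_K`-module, `P, Q ∈ E[p]` with `P ≠ 0`, `Q ∉ ⟨P⟩`,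
`K(P,⟨Q⟩) = K̄^{Stab(P) ∩ Stab(⟨Q⟩)}`.  If every (equivalently one) cyclotomic `ℤ_p`-extension of `K(P,⟨Q⟩)` has
vanishing classical `μ`-invariant (`IwasawaTheory.ClassicalMuVanishes`, growth form), then for the cyclotomic
`ℤ_p`-extension `κ` of `K` the Pontryagin dual of `Sel₀(E/K_∞)[p^∞]` is finitely generated over `ℤ_p` — Conjecture A
of Coates–Sujatha for `E` at `p` over `K_∞`.  Compare Coates–Sujatha Thm. 3.4 (`μ_p(K(E[p])_cyc) = 0 ⟹` (A), tree
`thm34_…_holds`): `[K(E[p]) : K(P,⟨Q⟩)] = #res(Stab(P) ∩ Stab(⟨Q⟩))` (`= p - 1 = 2` for a `GL₂(𝔽₃)` image), and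
no tameness as in Deo–Ray–Sujatha Thm. 3.9 / the seat's Door L8.
[cite: CoatesSujatha2005, §3 Thm. 3.4 and Lemma 3.8] [cite: DeoRaySujatha2023, §3 Thm. 3.9 (b) and §5 Lemma 5.1]
[cite: Washington1997, §13.3 Prop. 13.23 (μ = 0 ⟹ bounded p-ranks)] -/
theorem conjA_of_classicalMuVanishes_pointLineField (hp : p ≠ 2) (hirr : W.HasIrreducibleModPGaloisRep p)
    (P Q : ↥(W.geomTorsion (p : ℤ))) (hP0 : P ≠ 0) (hQ : Q ∉ AddSubgroup.zmultiples P)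
    (hμ : ∀ κ' : ZpExtension ↥(fixedField (MulAction.stabilizer (absoluteGaloisGroup K) P ⊓
        MulAction.stabilizer (absoluteGaloisGroup K) (AddSubgroup.zmultiples Q)) :
          IntermediateField K (AlgebraicClosure K)) p, κ'.IsCyclotomic → ClassicalMuVanishes κ')
    (κ : ZpExtension K p) (hκ : κ.IsCyclotomic) :
    ∃ (γ : absoluteGaloisGroup K) (D : W.FineSelmerDualData κ γ),
      Module.Finite ℤ_[p] (RestrictScalars ℤ_[p] (IwasawaAlgebra p) D.X) := by
  haveI : NeZero p := ⟨(Fact.out : p.Prime).ne_zero⟩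
  exact conjA_of_classicalMuVanishes_fixedField W hp hirr _
    (fixingSubgroupOfModule_le_stabilizer_inf_stabilizer_zmultiples W P Q) P hP0 inf_le_left
    (not_dvd_natCard_map_stabilizer_inf_stabilizer_zmultiples W P Q hP0 hQ) hμ κ hκ

/-- **Binder-free form: `E[p]` irreducible (`p` odd) and `μ_p(K(P,⟨Q⟩)_cyc) = 0` for EVERY point–line pair
⟹ statement (A).**  (A pair `P ≠ 0`, `Q ∉ ⟨P⟩` exists, `exists_ne_zero_and_not_mem_zmultiples`; for a
`GL₂(𝔽_p)`-image curve all such pairs are conjugate, so the hypothesis is ONE `μ`-datum.)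
[cite: CoatesSujatha2005, §3 Thm. 3.4 and Lemma 3.8] [cite: DeoRaySujatha2023, §5 Lemma 5.1] -/
theorem conjA_of_forall_classicalMuVanishes_pointLineField (hp : p ≠ 2) (hirr : W.HasIrreducibleModPGaloisRep p)
    (hμ : ∀ P Q : ↥(W.geomTorsion (p : ℤ)), P ≠ 0 → Q ∉ AddSubgroup.zmultiples P →
      ∀ κ' : ZpExtension ↥(fixedField (MulAction.stabilizer (absoluteGaloisGroup K) P ⊓
        MulAction.stabilizer (absoluteGaloisGroup K) (AddSubgroup.zmultiples Q)) :
          IntermediateField K (AlgebraicClosure K)) p, κ'.IsCyclotomic → ClassicalMuVanishes κ')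
    (κ : ZpExtension K p) (hκ : κ.IsCyclotomic) :
    ∃ (γ : absoluteGaloisGroup K) (D : W.FineSelmerDualData κ γ),
      Module.Finite ℤ_[p] (RestrictScalars ℤ_[p] (IwasawaAlgebra p) D.X) := by
  haveI : NeZero p := ⟨(Fact.out : p.Prime).ne_zero⟩
  obtain ⟨P, Q, hP0, hQ⟩ := exists_ne_zero_and_not_mem_zmultiples W (p := p)
  exact conjA_of_classicalMuVanishes_pointLineField W hp hirr P Q hP0 hQ (hμ P Q hP0 hQ) κ hκ

/-! ## §3 Numeric doors at the point–line field `K(P,⟨Q⟩)` -/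

/-- **Door L9.1′ (Iwasawa 1956 at `K(P,⟨Q⟩)`): `p ∤ h(K(P,⟨Q⟩))` and ONE prime of `K(P,⟨Q⟩)` above `p` ⟹ statement
(A)** (`p` odd, `E[p]` irreducible, `P ≠ 0`, `Q ∉ ⟨P⟩`; no image hypothesis).
[cite: Greenberg2001IwasawaPastPresent, Prop. 2.1 p. 339] [cite: CoatesSujatha2005, §3 Thm. 3.4]
[cite: DeoRaySujatha2023, §3 Thm. 3.9 (b)] -/
theorem conjA_of_not_dvd_classNumber_pointLineField_of_unique_prime (hp : p ≠ 2)
    (hirr : W.HasIrreducibleModPGaloisRep p) (P Q : ↥(W.geomTorsion (p : ℤ))) (hP0 : P ≠ 0)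
    (hQ : Q ∉ AddSubgroup.zmultiples P)
    (hh : ∀ [NumberField ↥(fixedField (MulAction.stabilizer (absoluteGaloisGroup K) P ⊓
        MulAction.stabilizer (absoluteGaloisGroup K) (AddSubgroup.zmultiples Q)) :
          IntermediateField K (AlgebraicClosure K))],
      ¬ p ∣ NumberField.classNumber ↥(fixedField (MulAction.stabilizer (absoluteGaloisGroup K) P ⊓
        MulAction.stabilizer (absoluteGaloisGroup K) (AddSubgroup.zmultiples Q)) :
          IntermediateField K (AlgebraicClosure K)))
    (hv : ∃! v : HeightOneSpectrum (𝓞 ↥(fixedField (MulAction.stabilizer (absoluteGaloisGroup K) P ⊓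
        MulAction.stabilizer (absoluteGaloisGroup K) (AddSubgroup.zmultiples Q)) :
          IntermediateField K (AlgebraicClosure K))),
      ((p : ℕ) : 𝓞 ↥(fixedField (MulAction.stabilizer (absoluteGaloisGroup K) P ⊓
        MulAction.stabilizer (absoluteGaloisGroup K) (AddSubgroup.zmultiples Q)) :
          IntermediateField K (AlgebraicClosure K))) ∈ v.asIdeal)
    (κ : ZpExtension K p) (hκ : κ.IsCyclotomic) :
    ∃ (γ : absoluteGaloisGroup K) (D : W.FineSelmerDualData κ γ),
      Module.Finite ℤ_[p] (RestrictScalars ℤ_[p] (IwasawaAlgebra p) D.X) := by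
  haveI : NeZero p := ⟨(Fact.out : p.Prime).ne_zero⟩
  exact conjA_of_not_dvd_classNumber_fixedField_of_unique_prime W hp hirr _
    (fixingSubgroupOfModule_le_stabilizer_inf_stabilizer_zmultiples W P Q) P hP0 inf_le_left
    (not_dvd_natCard_map_stabilizer_inf_stabilizer_zmultiples W P Q hP0 hQ) @hh hv κ hκ

/-- **Door L9.2′ (Fukuda 1994 Thm. 1 (1) at `K(P,⟨Q⟩)`): `ord_p h` of the layers `n + 1` and `n` of the cyclotomic
tower of `K(P,⟨Q⟩)` agree for ONE `n ≥ n₀` (total ramification above `p` from layer `n₀`) ⟹ statement (A)**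
(`p` odd, `E[p]` irreducible, `P ≠ 0`, `Q ∉ ⟨P⟩`; no image hypothesis). [cite: Fukuda1994, Thm. 1 (1), p. 264]
[cite: CoatesSujatha2005, §3 Thm. 3.4] [cite: DeoRaySujatha2023, §5 Lemma 5.1] -/
theorem conjA_of_classNumberPExp_pointLineField_succ_eq (hp : p ≠ 2) (hirr : W.HasIrreducibleModPGaloisRep p)
    (P Q : ↥(W.geomTorsion (p : ℤ))) (hP0 : P ≠ 0) (hQ : Q ∉ AddSubgroup.zmultiples P) (n₀ n : ℕ) (hn : n₀ ≤ n)
    (hram : ∀ κ' : ZpExtension ↥(fixedField (MulAction.stabilizer (absoluteGaloisGroup K) P ⊓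
        MulAction.stabilizer (absoluteGaloisGroup K) (AddSubgroup.zmultiples Q)) :
          IntermediateField K (AlgebraicClosure K)) p, κ'.IsCyclotomic → TotallyRamifiedFrom κ' n₀)
    (hord : ∀ κ' : ZpExtension ↥(fixedField (MulAction.stabilizer (absoluteGaloisGroup K) P ⊓
        MulAction.stabilizer (absoluteGaloisGroup K) (AddSubgroup.zmultiples Q)) :
          IntermediateField K (AlgebraicClosure K)) p,
      κ'.IsCyclotomic → classNumberPExp κ' (n + 1) = classNumberPExp κ' n)
    (κ : ZpExtension K p) (hκ : κ.IsCyclotomic) :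
    ∃ (γ : absoluteGaloisGroup K) (D : W.FineSelmerDualData κ γ),
      Module.Finite ℤ_[p] (RestrictScalars ℤ_[p] (IwasawaAlgebra p) D.X) := by
  haveI : NeZero p := ⟨(Fact.out : p.Prime).ne_zero⟩
  exact conjA_of_classNumberPExp_fixedField_succ_eq W hp hirr _
    (fixingSubgroupOfModule_le_stabilizer_inf_stabilizer_zmultiples W P Q) P hP0 inf_le_left
    (not_dvd_natCard_map_stabilizer_inf_stabilizer_zmultiples W P Q hP0 hQ) n₀ n hn hram hord κ hκ

/-- **Door L9.3′ (Fukuda 1994 Thm. 1 (2) at `K(P,⟨Q⟩)`): `rank_p Cl` of the layers `n + 1` and `n` of the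
cyclotomic tower of `K(P,⟨Q⟩)` agree for ONE `n ≥ n₀` (total ramification above `p` from layer `n₀`) ⟹ statement
(A)** (`p` odd, `E[p]` irreducible, `P ≠ 0`, `Q ∉ ⟨P⟩`; no image hypothesis).  For `K = ℚ`, `p = 3` and a
`GL₂(𝔽₃)`-image curve: ONE comparison of the `3`-ranks of the class groups of `ℚ(x_P, y_P, x_Q)` (degree `24`)
and of its layer `ℚ(x_P, y_P, x_Q)·ℚ_1` (degree `72`), plus the ramification datum.
[cite: Fukuda1994, Thm. 1 (2), p. 264] [cite: CoatesSujatha2005, §3 Thm. 3.4] [cite: DeoRaySujatha2023, §5 Lemma 5.1] -/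
theorem conjA_of_classGroupPRank_pointLineField_succ_eq (hp : p ≠ 2) (hirr : W.HasIrreducibleModPGaloisRep p)
    (P Q : ↥(W.geomTorsion (p : ℤ))) (hP0 : P ≠ 0) (hQ : Q ∉ AddSubgroup.zmultiples P) (n₀ n : ℕ) (hn : n₀ ≤ n)
    (hram : ∀ κ' : ZpExtension ↥(fixedField (MulAction.stabilizer (absoluteGaloisGroup K) P ⊓
        MulAction.stabilizer (absoluteGaloisGroup K) (AddSubgroup.zmultiples Q)) :
          IntermediateField K (AlgebraicClosure K)) p, κ'.IsCyclotomic → TotallyRamifiedFrom κ' n₀)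
    (hrk : ∀ κ' : ZpExtension ↥(fixedField (MulAction.stabilizer (absoluteGaloisGroup K) P ⊓
        MulAction.stabilizer (absoluteGaloisGroup K) (AddSubgroup.zmultiples Q)) :
          IntermediateField K (AlgebraicClosure K)) p,
      κ'.IsCyclotomic → classGroupPRank κ' (n + 1) = classGroupPRank κ' n)
    (κ : ZpExtension K p) (hκ : κ.IsCyclotomic) :
    ∃ (γ : absoluteGaloisGroup K) (D : W.FineSelmerDualData κ γ),
      Module.Finite ℤ_[p] (RestrictScalars ℤ_[p] (IwasawaAlgebra p) D.X) := by
  haveI : NeZero p := ⟨(Fact.out : p.Prime).ne_zero⟩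
  exact conjA_of_classGroupPRank_fixedField_succ_eq W hp hirr _
    (fixingSubgroupOfModule_le_stabilizer_inf_stabilizer_zmultiples W P Q) P hP0 inf_le_left
    (not_dvd_natCard_map_stabilizer_inf_stabilizer_zmultiples W P Q hP0 hQ) n₀ n hn hram hrk κ hκ

/-- **Door L9.1″ (binder-free Iwasawa-1956 form): if for EVERY point–line pair `p ∤ h(K(P,⟨Q⟩))` and
`K(P,⟨Q⟩)` has ONE prime above `p`, then statement (A)** (`p` odd, `E[p]` irreducible; no image hypothesis).
[cite: Greenberg2001IwasawaPastPresent, Prop. 2.1 p. 339] [cite: CoatesSujatha2005, §3 Thm. 3.4] -/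
theorem conjA_of_forall_not_dvd_classNumber_pointLineField_of_unique_prime (hp : p ≠ 2)
    (hirr : W.HasIrreducibleModPGaloisRep p)
    (h : ∀ P Q : ↥(W.geomTorsion (p : ℤ)), P ≠ 0 → Q ∉ AddSubgroup.zmultiples P →
      (∀ [NumberField ↥(fixedField (MulAction.stabilizer (absoluteGaloisGroup K) P ⊓
          MulAction.stabilizer (absoluteGaloisGroup K) (AddSubgroup.zmultiples Q)) :
            IntermediateField K (AlgebraicClosure K))],
        ¬ p ∣ NumberField.classNumber ↥(fixedField (MulAction.stabilizer (absoluteGaloisGroup K) P ⊓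
          MulAction.stabilizer (absoluteGaloisGroup K) (AddSubgroup.zmultiples Q)) :
            IntermediateField K (AlgebraicClosure K))) ∧
      ∃! v : HeightOneSpectrum (𝓞 ↥(fixedField (MulAction.stabilizer (absoluteGaloisGroup K) P ⊓
          MulAction.stabilizer (absoluteGaloisGroup K) (AddSubgroup.zmultiples Q)) :
            IntermediateField K (AlgebraicClosure K))),
        ((p : ℕ) : 𝓞 ↥(fixedField (MulAction.stabilizer (absoluteGaloisGroup K) P ⊓
          MulAction.stabilizer (absoluteGaloisGroup K) (AddSubgroup.zmultiples Q)) :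
            IntermediateField K (AlgebraicClosure K))) ∈ v.asIdeal)
    (κ : ZpExtension K p) (hκ : κ.IsCyclotomic) :
    ∃ (γ : absoluteGaloisGroup K) (D : W.FineSelmerDualData κ γ),
      Module.Finite ℤ_[p] (RestrictScalars ℤ_[p] (IwasawaAlgebra p) D.X) := by
  haveI : NeZero p := ⟨(Fact.out : p.Prime).ne_zero⟩
  obtain ⟨P, Q, hP0, hQ⟩ := exists_ne_zero_and_not_mem_zmultiples W (p := p)
  obtain ⟨hh, hv⟩ := h P Q hP0 hQ
  exact conjA_of_not_dvd_classNumber_pointLineField_of_unique_prime W hp hirr P Q hP0 hQ @hh hv κ hκ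

/-- **Door L9.3″ (binder-free Fukuda form): if for EVERY point–line pair the cyclotomic `ℤ_p`-extensions of
`K(P,⟨Q⟩)` are totally ramified above `p` from layer `n₀` and `rank_p Cl` agrees at the layers `n + 1` and `n`
(`n ≥ n₀`), then statement (A)** (`p` odd, `E[p]` irreducible; no image hypothesis; on a `GL₂(𝔽_p)`-image curve all
point–line pairs are conjugate, so this is ONE pair of integers and one ramification datum).
[cite: Fukuda1994, Thm. 1 (2), p. 264] [cite: CoatesSujatha2005, §3 Thm. 3.4] -/
theorem conjA_of_forall_classGroupPRank_pointLineField_succ_eq (hp : p ≠ 2)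
    (hirr : W.HasIrreducibleModPGaloisRep p) (n₀ n : ℕ) (hn : n₀ ≤ n)
    (h : ∀ P Q : ↥(W.geomTorsion (p : ℤ)), P ≠ 0 → Q ∉ AddSubgroup.zmultiples P →
      ∀ κ' : ZpExtension ↥(fixedField (MulAction.stabilizer (absoluteGaloisGroup K) P ⊓
        MulAction.stabilizer (absoluteGaloisGroup K) (AddSubgroup.zmultiples Q)) :
          IntermediateField K (AlgebraicClosure K)) p,
        κ'.IsCyclotomic → TotallyRamifiedFrom κ' n₀ ∧ classGroupPRank κ' (n + 1) = classGroupPRank κ' n)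
    (κ : ZpExtension K p) (hκ : κ.IsCyclotomic) :
    ∃ (γ : absoluteGaloisGroup K) (D : W.FineSelmerDualData κ γ),
      Module.Finite ℤ_[p] (RestrictScalars ℤ_[p] (IwasawaAlgebra p) D.X) := by
  haveI : NeZero p := ⟨(Fact.out : p.Prime).ne_zero⟩
  obtain ⟨P, Q, hP0, hQ⟩ := exists_ne_zero_and_not_mem_zmultiples W (p := p)
  exact conjA_of_classGroupPRank_pointLineField_succ_eq W hp hirr P Q hP0 hQ n₀ n hn
    (fun κ' hκ' => (h P Q hP0 hQ κ' hκ').1) (fun κ' hκ' => (h P Q hP0 hQ κ' hκ').2) κ hκ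

end Literature.NumberTheory.EllipticCurves.CoatesSujatha2005

end
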